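import Summits.QuantumFields.YangMills.Theorems.EntropyBudgetEquipartitionBudgetRate
import Literature.MathematicalPhysics.QuantumLattice.TorusWilsonGibbs
import Literature.MathematicalPhysics.QuantumFieldTheory.WilsonEnergyConvexity
import Literature.Probability.Divergences.KLDivConvexity
import HarnessLib

/-!
# Route `EntropyBudgetEquipartition`, crux `EntropyBudgetTransfer` (stmt-QuantumFields-22401) — the Gibbs entropy identity on the torus and the SCALE ENTROPY of lattice Yang–Mills with rate

HONEST LABEL: helper lemmas toward a RECORD-label rung (R2ξ-G, `WeakCouplingRates.XiPow`, an UPPER bound on the lattice gap);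
nothing here bears on the Clay Yang–Mills mass gap, which is NOT proved by any of this.

The route's engine (i) («a free-energy RATE is an entropy budget», Theses/EntropyBudgetEquipartition.lean) is the exact Gibbs
identity `H(μ | γ) = (log Z_γ − log Z_μ) + E_μ[H_γ − H_μ]` for two Gibbs states on the same torus.  This file puts that identity
in the tree for Mathlib's `InformationTheory.klDiv` and the tree's torus Wilson states, in the one family of reference states
the tree can build today — the Wilson states at another coupling (the Gaussian reference of KT2 needs a gauge) — and evaluates
the resulting SCALE ENTROPY with a power rate from K1 (`FreeEnergyRate`, proved) and KT1 (`BudgetRate.budgetRate_torus`):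

* (general, any probability space) `toReal_klDiv_tilted_left` / `toReal_klDiv_tilted_right`: for a bounded measurable `f`,
  `KL(μ^f ‖ μ) = E_{μ^f}[f] − log E_μ e^f` and `KL(μ ‖ μ^f) = log E_μ e^f − E_μ[f]` (`μ^f = μ.tilted f` the Gibbs reweighting),
  both finite; hence the two-sided Gibbs–Peierls–Bogoliubov bounds `E_μ[f] ≤ log E_μ e^f ≤ E_{μ^f}[f]`
  (`integral_le_log_integral_exp`, `log_integral_exp_le_integral_tilted`);
* (Wilson) `wilsonMeasure_tilted` : tilting `μ_{Λ,β}` by `−t S_W` gives `μ_{Λ,β+t}`; `log_wilsonExpectation_exp` :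
  `log ⟨e^{−t S}⟩_β = log Z(β+t) − log Z(β)`; `toReal_klDiv_wilsonMeasure` : the **Gibbs identity in `β`**
  `KL(μ_{Λ,β'} ‖ μ_{Λ,β}) = log Z_Λ(β) − log Z_Λ(β') − (β' − β) ⟨S⟩_{Λ,β'}` (finite), and its per-site form
  `klDiv_wilsonMeasure_perSite` with the site energy `s₀`;
* (rate) `scaleEntropy_rate` : IF `|f_r(β) + (3D/2) log β − K| ≤ C β^{−κ}` for `β ≥ β₀` (K1's body), THEN for `β₁ ≤ β ≤ β'`,
  eventually in the torus size `L+1`,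
  `| |Λ|⁻¹ KL(μ_{Λ,β'} ‖ μ_{Λ,β}) − (3D/2)·(log(β'/β) − 1 + β/β') | ≤ C' β^{−κ/2}`:
  the specific relative entropy between the Yang–Mills states at two weak couplings IS the free-gluon value
  (`3D` Gaussian modes per site, `½(1/λ − 1 + log λ)` each, `λ = β'/β`) up to a power of `β` — the entropy-currency
  form of local Gaussianity at the level of densities, which is what K1 + KT1 buy without any gauge fixing.

References: Gibbs variational identity / specific entropy (S. Friedli, Y. Velenik, CUP 2017, ch. 6; H. Föllmer in
Albeverio et al., Saint-Flour), Donsker–Varadhan; the tree's `WilsonEnergyConvexity` (supporting line = `KL ≥ 0`).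
[FriedliVelenik2017] [folklore]
-/

noncomputable section

namespace Summit.QuantumFields.YangMills.Theorems.EntropyBudgetEquipartition.ScaleEntropy

open MeasureTheory Filter Topology InformationTheory
open Literature.MathematicalPhysics.QuantumLattice Literature.MathematicalPhysics.QuantumFieldTheory

/-! ### Relative entropy of a Gibbs reweighting (tilt) of a probability measure -/

section Tilt

variable {Ω : Type*} [MeasurableSpace Ω] {μ : Measure Ω} [IsProbabilityMeasure μ] {f : Ω → ℝ} {B : ℝ}

/-- A bounded measurable real function has an integrable exponential under a probability measure. [folklore] -/
theorem integrable_exp_of_abs_le (hf : Measurable f) (hB : ∀ ω, |f ω| ≤ B) :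
    Integrable (fun ω => Real.exp (f ω)) μ := by
  refine Integrable.of_bound hf.exp.aestronglyMeasurable (Real.exp B) (ae_of_all _ fun ω => ?_)
  rw [Real.norm_eq_abs, abs_of_pos (Real.exp_pos _), Real.exp_le_exp]
  exact (le_abs_self _).trans (hB ω)

/-- A bounded measurable real function is integrable under every finite measure. [folklore] -/
theorem integrable_of_abs_le {ν : Measure Ω} [IsFiniteMeasure ν] (hf : Measurable f) (hB : ∀ ω, |f ω| ≤ B) :
    Integrable f ν :=
  Integrable.of_bound hf.aestronglyMeasurable B (ae_of_all _ fun ω => by rw [Real.norm_eq_abs]; exact hB ω)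

/-- The log-likelihood ratio of the tilt `μ^f = μ.tilted f` against `μ` is `f − log E_μ e^f`, almost surely under the tilt. [folklore] -/
theorem llr_tilted_self (hf : Measurable f) (hB : ∀ ω, |f ω| ≤ B) :
    llr (μ.tilted f) μ =ᵐ[μ.tilted f] fun ω => f ω - Real.log (∫ z, Real.exp (f z) ∂μ) := by
  have h1 : llr (μ.tilted f) μ =ᵐ[μ] fun ω => f ω - Real.log (∫ z, Real.exp (f z) ∂μ) + llr μ μ ω :=
    llr_tilted_left (Measure.AbsolutelyContinuous.rfl) (integrable_exp_of_abs_le hf hB) hf.aemeasurable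
  have h2 : llr μ μ =ᵐ[μ] 0 := llr_self μ
  have h3 : llr (μ.tilted f) μ =ᵐ[μ] fun ω => f ω - Real.log (∫ z, Real.exp (f z) ∂μ) := by
    filter_upwards [h1, h2] with ω hω hω'
    rw [hω, hω', Pi.zero_apply, add_zero]
  exact (tilted_absolutelyContinuous μ f).ae_le h3

/-- The log-likelihood ratio of `μ` against its tilt `μ^f` is `log E_μ e^f − f`, almost surely under `μ`. [folklore] -/
theorem llr_self_tilted (hf : Measurable f) (hB : ∀ ω, |f ω| ≤ B) :
    llr μ (μ.tilted f) =ᵐ[μ] fun ω => -f ω + Real.log (∫ z, Real.exp (f z) ∂μ) := by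
  have h1 : llr μ (μ.tilted f) =ᵐ[μ] fun ω => -f ω + Real.log (∫ z, Real.exp (f z) ∂μ) + llr μ μ ω :=
    llr_tilted_right (Measure.AbsolutelyContinuous.rfl) (integrable_exp_of_abs_le hf hB)
  have h2 : llr μ μ =ᵐ[μ] 0 := llr_self μ
  filter_upwards [h1, h2] with ω hω hω'
  rw [hω, hω', Pi.zero_apply, add_zero]

/-- **Relative entropy of a tilt, forward**: for bounded measurable `f`, `KL(μ^f ‖ μ)` is finite and equals
`E_{μ^f}[f] − log E_μ e^f`. [folklore] -/
theorem toReal_klDiv_tilted_left (hf : Measurable f) (hB : ∀ ω, |f ω| ≤ B) :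
    klDiv (μ.tilted f) μ ≠ ⊤ ∧
      (klDiv (μ.tilted f) μ).toReal = (∫ ω, f ω ∂(μ.tilted f)) - Real.log (∫ ω, Real.exp (f ω) ∂μ) := by
  haveI : IsProbabilityMeasure (μ.tilted f) := isProbabilityMeasure_tilted (integrable_exp_of_abs_le hf hB)
  have hint : Integrable (fun ω => f ω - Real.log (∫ z, Real.exp (f z) ∂μ)) (μ.tilted f) :=
    (integrable_of_abs_le hf hB).sub (integrable_const _)
  have hllr : Integrable (llr (μ.tilted f) μ) (μ.tilted f) := (integrable_congr (llr_tilted_self hf hB)).2 hint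
  refine ⟨klDiv_ne_top (tilted_absolutelyContinuous μ f) hllr, ?_⟩
  rw [toReal_klDiv_of_measure_eq (tilted_absolutelyContinuous μ f) (by simp), integral_congr_ae (llr_tilted_self hf hB),
    integral_sub (integrable_of_abs_le hf hB) (integrable_const _), integral_const, probReal_univ, one_smul]

/-- **Relative entropy of a tilt, backward**: for bounded measurable `f`, `KL(μ ‖ μ^f)` is finite and equals
`log E_μ e^f − E_μ[f]`. [folklore] -/
theorem toReal_klDiv_tilted_right (hf : Measurable f) (hB : ∀ ω, |f ω| ≤ B) :
    klDiv μ (μ.tilted f) ≠ ⊤ ∧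
      (klDiv μ (μ.tilted f)).toReal = Real.log (∫ ω, Real.exp (f ω) ∂μ) - ∫ ω, f ω ∂μ := by
  haveI : IsProbabilityMeasure (μ.tilted f) := isProbabilityMeasure_tilted (integrable_exp_of_abs_le hf hB)
  have hac : μ ≪ μ.tilted f := absolutelyContinuous_tilted (integrable_exp_of_abs_le hf hB)
  have hint : Integrable (fun ω => -f ω + Real.log (∫ z, Real.exp (f z) ∂μ)) μ :=
    (integrable_of_abs_le hf hB).neg.add (integrable_const _)
  have hllr : Integrable (llr μ (μ.tilted f)) μ := (integrable_congr (llr_self_tilted hf hB)).2 hint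
  refine ⟨klDiv_ne_top hac hllr, ?_⟩
  rw [toReal_klDiv_of_measure_eq hac (by simp), integral_congr_ae (llr_self_tilted hf hB)]
  have hfun : (fun ω => -f ω + Real.log (∫ z, Real.exp (f z) ∂μ)) = fun ω => Real.log (∫ z, Real.exp (f z) ∂μ) - f ω :=
    funext fun ω => by ring
  rw [hfun, integral_sub (integrable_const _) (integrable_of_abs_le hf hB), integral_const, probReal_univ, one_smul]

/-- **Gibbs–Jensen**: `E_μ[f] ≤ log E_μ e^f` (the backward relative entropy of the tilt is `≥ 0`). [folklore] -/
theorem integral_le_log_integral_exp (hf : Measurable f) (hB : ∀ ω, |f ω| ≤ B) :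
    ∫ ω, f ω ∂μ ≤ Real.log (∫ ω, Real.exp (f ω) ∂μ) := by
  have h := (toReal_klDiv_tilted_right (μ := μ) hf hB).2
  have h0 : 0 ≤ (klDiv μ (μ.tilted f)).toReal := ENNReal.toReal_nonneg
  linarith

/-- **Gibbs–Peierls–Bogoliubov**: `log E_μ e^f ≤ E_{μ^f}[f]` (the forward relative entropy of the tilt is `≥ 0`). [folklore] -/
theorem log_integral_exp_le_integral_tilted (hf : Measurable f) (hB : ∀ ω, |f ω| ≤ B) :
    Real.log (∫ ω, Real.exp (f ω) ∂μ) ≤ ∫ ω, f ω ∂(μ.tilted f) := by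
  have h := (toReal_klDiv_tilted_left (μ := μ) hf hB).2
  have h0 : 0 ≤ (klDiv (μ.tilted f) μ).toReal := ENNReal.toReal_nonneg
  linarith

/-- **Entropy (Donsker–Varadhan) inequality against a tilt**: for bounded measurable `f, ψ`,
`E_{μ^f}[ψ] ≤ KL(μ^f ‖ μ) + log E_μ e^ψ` — the transfer device of the relative entropy method, with the budget
`KL(μ^f ‖ μ) = E_{μ^f}[f] − log E_μ e^f`. [folklore] -/
theorem integral_tilted_le_klDiv_add_log (hf : Measurable f) (hB : ∀ ω, |f ω| ≤ B) {ψ : Ω → ℝ} (hψ : Measurable ψ)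
    {C : ℝ} (hC : ∀ ω, |ψ ω| ≤ C) :
    ∫ ω, ψ ω ∂(μ.tilted f) ≤ (klDiv (μ.tilted f) μ).toReal + Real.log (∫ ω, Real.exp (ψ ω) ∂μ) := by
  haveI : IsProbabilityMeasure (μ.tilted f) := isProbabilityMeasure_tilted (integrable_exp_of_abs_le hf hB)
  exact Literature.Probability.Divergences.integral_le_toReal_klDiv_add_log (toReal_klDiv_tilted_left hf hB).1 hψ hC

end Tilt

/-! ### The torus Wilson states: tilting in the coupling, the Gibbs identity in `β` -/

section Wilson

variable {d L N : ℕ} {G : Type*} [Group G] [TopologicalSpace G] [IsTopologicalGroup G] [CompactSpace G]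
  [MeasurableSpace G] [BorelSpace G] [SecondCountableTopology G] (ρ : G →* Matrix (Fin N) (Fin N) ℂ)

/-- **Tilting the Wilson state in the coupling**: `μ_{Λ,β}` reweighted by `e^{−t S_W}` is `μ_{Λ,β+t}`. [folklore] -/
theorem wilsonMeasure_tilted [NeZero L] (hρ : Continuous ρ) (β t : ℝ) :
    (wilsonMeasure (d := d) (L := L) ρ β).tilted (fun U => -t * wilsonAction ρ U) =
      wilsonMeasure (d := d) (L := L) ρ (β + t) := by
  rw [wilsonMeasure_eq_tilted_pi ρ hρ β, wilsonMeasure_eq_tilted_pi ρ hρ (β + t),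
    tilted_tilted (integrable_exp_mul_wilsonAction ρ hρ (-β) _)]
  congr 1
  funext U
  simp only [Pi.add_apply]
  ring

omit [SecondCountableTopology G] in
/-- `log ⟨e^{−t S}⟩_{Λ,β} = log Z_Λ(β + t) − log Z_Λ(β)`. [folklore] -/
theorem log_wilsonExpectation_exp [NeZero L] (hρ : Continuous ρ) (β t : ℝ) :
    Real.log (wilsonExpectation (d := d) (L := L) ρ β fun U => Real.exp (-t * wilsonAction ρ U)) =
      torusLogPartition d ρ (β + t) L - torusLogPartition d ρ β L := by
  rw [wilsonExpectation_eq_integral_div ρ hρ β, torusLogPartition_eq_log_integral ρ hρ (β + t),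
    torusLogPartition_eq_log_integral ρ hρ β]
  have hnum : (∫ U, Real.exp (-t * wilsonAction ρ U) * Real.exp (-β * wilsonAction ρ U)
      ∂(Measure.pi fun _ : Edge d L => haarProbability G)) =
      ∫ U, Real.exp (-(β + t) * wilsonAction ρ U) ∂(Measure.pi fun _ : Edge d L => haarProbability G) := by
    refine integral_congr_ae (ae_of_all _ fun U => ?_)
    show Real.exp (-t * wilsonAction ρ U) * Real.exp (-β * wilsonAction ρ U) = Real.exp (-(β + t) * wilsonAction ρ U)
    rw [← Real.exp_add]; ring_nf
  rw [hnum, Real.log_div (integral_exp_neg_mul_wilsonAction_pos ρ hρ (β + t)).ne'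
    (integral_exp_neg_mul_wilsonAction_pos ρ hρ β).ne']

/-- **The Gibbs identity in the coupling (scale entropy), exact on every torus**: for all real `β, β'`,
`KL(μ_{Λ,β'} ‖ μ_{Λ,β})` is finite and equals `log Z_Λ(β) − log Z_Λ(β') − (β' − β) ⟨S_W⟩_{Λ,β'}`. [folklore] -/
theorem toReal_klDiv_wilsonMeasure [NeZero L] (hρ : Continuous ρ) (β β' : ℝ) :
    klDiv (wilsonMeasure (d := d) (L := L) ρ β') (wilsonMeasure (d := d) (L := L) ρ β) ≠ ⊤ ∧
      (klDiv (wilsonMeasure (d := d) (L := L) ρ β') (wilsonMeasure (d := d) (L := L) ρ β)).toReal =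
        torusLogPartition d ρ β L - torusLogPartition d ρ β' L -
          (β' - β) * wilsonExpectation (d := d) (L := L) ρ β' (wilsonAction ρ) := by
  haveI := isProbabilityMeasure_wilsonMeasure (d := d) (L := L) ρ hρ β
  obtain ⟨B, hB⟩ := exists_abs_wilsonAction_le (d := d) (L := L) ρ hρ
  set t : ℝ := β' - β with ht
  have hf : Measurable fun U : GaugeConfig d L G => -t * wilsonAction ρ U := (measurable_wilsonAction ρ hρ).const_mul _
  have hfB : ∀ U : GaugeConfig d L G, |-t * wilsonAction ρ U| ≤ |t| * B := fun U => by
    rw [abs_mul, abs_neg]; exact mul_le_mul_of_nonneg_left (hB U) (abs_nonneg _)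
  have key := toReal_klDiv_tilted_left (μ := wilsonMeasure (d := d) (L := L) ρ β) hf hfB
  have hβ' : β + t = β' := by rw [ht]; ring
  rw [wilsonMeasure_tilted ρ hρ β t, hβ'] at key
  refine ⟨key.1, ?_⟩
  rw [key.2]
  have h1 : (∫ U, -t * wilsonAction ρ U ∂(wilsonMeasure (d := d) (L := L) ρ β')) =
      -t * wilsonExpectation (d := d) (L := L) ρ β' (wilsonAction ρ) := by
    rw [integral_const_mul]; rfl
  have h2 : Real.log (∫ U, Real.exp (-t * wilsonAction ρ U) ∂(wilsonMeasure (d := d) (L := L) ρ β)) =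
      torusLogPartition d ρ β' L - torusLogPartition d ρ β L := by
    rw [← hβ']; exact log_wilsonExpectation_exp ρ hρ β t
  rw [h1, h2, ht]
  ring

/-- **The Gibbs identity in the coupling, per site**: on the torus of side `M`,
`|Λ|⁻¹ KL(μ_{Λ,β'} ‖ μ_{Λ,β}) = f_M(β) − f_M(β') − (β' − β) ⟨s₀⟩_{M,β'}` with `f_M = M^{−d} log Z_M` and `s₀` the Wilson
energy of the plaquettes at the origin read through the periodic lift (translation invariance, `⟨S⟩ = M^d ⟨s₀⟩`). [folklore] -/
theorem klDiv_wilsonMeasure_perSite (hρ : Continuous ρ) (β β' : ℝ) (M : ℕ) [NeZero M] :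
    ((M : ℝ) ^ d)⁻¹ * (klDiv (wilsonMeasure (d := d) (L := M) ρ β') (wilsonMeasure (d := d) (L := M) ρ β)).toReal =
      ((M : ℝ) ^ d)⁻¹ * torusLogPartition d ρ β M - ((M : ℝ) ^ d)⁻¹ * torusLogPartition d ρ β' M -
        (β' - β) * wilsonExpectation (d := d) (L := M) ρ β' (toTorusObservable M fun U : LGConfig d G =>
          ∑ i : Fin d, ∑ j : Fin d, if i < j then ((N : ℝ) - plaquetteObs ρ 0 i j U) else 0) := by
  have hM : (0 : ℝ) < (M : ℝ) ^ d := pow_pos (Nat.cast_pos.2 (Nat.pos_of_ne_zero (NeZero.ne M))) d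
  rw [(toReal_klDiv_wilsonMeasure (d := d) (L := M) ρ hρ β β').2,
    EquipartitionPinsProbe.Equipartition.wilsonExpectation_wilsonAction_eq ρ hρ β' M,
    EquipartitionPinsProbe.Equipartition.toTorusObservable_siteEnergy ρ M]
  field_simp

end Wilson

/-! ### The scale entropy of lattice Yang–Mills with rate (K1 + KT1) -/

section Rate

variable {G : Type} [Group G] [TopologicalSpace G] [IsTopologicalGroup G] [CompactSpace G]
  [MeasurableSpace G] [BorelSpace G]

/-- Real arithmetic of the scale entropy: the per-site identity `h = fL β − fL β' − (β'−β) e'`, the free energies within `η`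
of their limits, the K1 rate at `β` and `β'`, and the KT1 rate `|β' e' − c| ≤ C₁ β'^{−κ/2} ≤ C₁ x` with `0 ≤ 1 − β/β' ≤ 1`
give `|h − c (log(β'/β) − 1 + β/β')| ≤ 2Cε + 2η + C₁ x`. [folklore] -/
theorem scaleEntropy_arith {h fLβ fLβ' fβ fβ' e' β β' c K C ε η C₁ x y : ℝ} (hβ : 0 < β) (hββ' : β ≤ β')
    (hid : h = fLβ - fLβ' - (β' - β) * e')
    (h1 : |fLβ - fβ| ≤ η) (h2 : |fLβ' - fβ'| ≤ η)
    (k1 : |fβ + c * Real.log β - K| ≤ C * ε) (k2 : |fβ' + c * Real.log β' - K| ≤ C * ε)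
    (kt : |β' * e' - c| ≤ C₁ * y) (hyx : y ≤ x) (hC₁ : 0 ≤ C₁) :
    |h - c * (Real.log (β' / β) - 1 + β / β')| ≤ 2 * (C * ε) + 2 * η + C₁ * x := by
  have hβ'pos : 0 < β' := lt_of_lt_of_le hβ hββ'
  have hlog : Real.log (β' / β) = Real.log β' - Real.log β := Real.log_div hβ'pos.ne' hβ.ne'
  -- the KT1 term: (β' - β) e' = (1 - β/β') (β' e'), with 0 ≤ 1 - β/β' ≤ 1
  set u : ℝ := 1 - β / β' with hu
  have hu0 : 0 ≤ u := by rw [hu, sub_nonneg, div_le_one hβ'pos]; exact hββ'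
  have hu1 : u ≤ 1 := by rw [hu]; have : 0 ≤ β / β' := div_nonneg hβ.le hβ'pos.le; linarith
  have hterm : (β' - β) * e' = u * (β' * e') := by
    rw [hu]; field_simp
  have hkt : |u * (β' * e') - u * c| ≤ C₁ * x := by
    rw [← mul_sub, abs_mul, abs_of_nonneg hu0]
    calc u * |β' * e' - c| ≤ 1 * (C₁ * y) := mul_le_mul hu1 kt (abs_nonneg _) zero_le_one
      _ ≤ C₁ * x := by rw [one_mul]; exact mul_le_mul_of_nonneg_left hyx hC₁
  have htarget : c * (Real.log (β' / β) - 1 + β / β') = (K - c * Real.log β) - (K - c * Real.log β') - u * c := by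
    rw [hlog, hu]; ring
  rw [hid, hterm, htarget]
  have e1 := abs_le.1 h1
  have e2 := abs_le.1 h2
  have e3 := abs_le.1 k1
  have e4 := abs_le.1 k2
  have e5 := abs_le.1 hkt
  rw [abs_le]
  constructor <;> linarith

/-- **Scale entropy of lattice Yang–Mills with rate.**  For a compact group `G` with a faithful continuous unitary lattice
representation `r`: IF the torus free energy per site obeys the K1 rate `|f_r(β) + (3D/2) log β − K| ≤ C β^{−κ}` for `β ≥ β₀`
(the body of the crux `FreeEnergyRate`, proved in the tree for compact simple `G`), THEN there are `C'`, `β₁` such that for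
`β₁ ≤ β ≤ β'`, eventually in the torus size `L + 1`,
`| |Λ_{L+1}|⁻¹ · KL(μ_{Λ,β'} ‖ μ_{Λ,β}) − (3D/2)·(log(β'/β) − 1 + β/β') | ≤ C' β^{−κ/2}` —
the specific relative entropy of the Yang–Mills state at coupling `β'` with respect to the one at `β` is the free-gluon
(Gaussian, `3D` modes per site) value up to a power of `β`.  Proof: the exact per-site Gibbs identity
(`klDiv_wilsonMeasure_perSite`), convergence of the torus free energies (`exists_hasFreeEnergyDensity_holds`), the K1 rate at
`β` and `β'`, and KT1 (`BudgetRate.budgetRate_torus`) at `β'`.  A helper toward a RECORD-label rung crux; NOT the Clay gap.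
[cite: FriedliVelenik2017, ch. 6] -/
theorem scaleEntropy_rate (r : LatticeRep G) {D : ℕ} {K κ C β₀ : ℝ} (hκ : 0 < κ)
    (hrate : ∀ β : ℝ, β₀ ≤ β →
      |freeEnergyDensity 4 r.ρ β + (3 * (D : ℝ) / 2) * Real.log β - K| ≤ C * β ^ (-κ)) :
    ∃ C' β₁ : ℝ, ∀ β : ℝ, β₁ ≤ β → ∀ β' : ℝ, β ≤ β' → ∀ᶠ L : ℕ in atTop,
      |((L + 1 : ℝ) ^ 4)⁻¹ *
          (klDiv (wilsonMeasure (d := 4) (L := L + 1) r.ρ β') (wilsonMeasure (d := 4) (L := L + 1) r.ρ β)).toReal -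
        (3 * (D : ℝ) / 2) * (Real.log (β' / β) - 1 + β / β')| ≤ C' * β ^ (-(κ / 2)) := by
  haveI : SecondCountableTopology (Matrix (Fin r.N) (Fin r.N) ℂ) :=
    inferInstanceAs (SecondCountableTopology (Fin r.N → Fin r.N → ℂ))
  haveI : SecondCountableTopology G :=
    (r.continuous.isClosedEmbedding r.injective).isEmbedding.secondCountableTopology
  obtain ⟨C₁, β₁, hKT⟩ := BudgetRate.budgetRate_torus r (D := D) hκ hrate
  -- constants: `C₁' = max C₁ 0`, `Cp = max C 0`; threshold `max β₁ (max β₀ 1)`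
  refine ⟨2 * max C 0 + 2 + max C₁ 0, max β₁ (max β₀ 1), fun β hβ β' hββ' => ?_⟩
  have hβ1 : β₁ ≤ β := (le_max_left _ _).trans hβ
  have hβ0 : β₀ ≤ β := ((le_max_left _ _).trans (le_max_right _ _)).trans hβ
  have hβone : (1 : ℝ) ≤ β := ((le_max_right _ _).trans (le_max_right _ _)).trans hβ
  have hβpos : 0 < β := by linarith
  have hβ'1 : β₁ ≤ β' := hβ1.trans hββ'
  have hβ'0 : β₀ ≤ β' := hβ0.trans hββ'
  have hβ'pos : 0 < β' := lt_of_lt_of_le hβpos hββ'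
  set f : ℝ → ℝ := freeEnergyDensity 4 r.ρ with hf
  set fL : ℝ → ℕ → ℝ := fun y L => (((L + 1 : ℕ) : ℝ) ^ 4)⁻¹ * torusLogPartition 4 r.ρ y (L + 1) with hfL
  have hconv : ∀ y : ℝ, Tendsto (fL y) atTop (𝓝 (f y)) := fun y =>
    hasFreeEnergyDensity_freeEnergyDensity r.ρ (exists_hasFreeEnergyDensity_holds (d := 4) r.ρ r.continuous y)
  -- slack `η = β^{-κ}` in the two free-energy limits
  set η : ℝ := β ^ (-κ) with hη
  have hη0 : 0 < η := Real.rpow_pos_of_pos hβpos _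
  have ev1 : ∀ᶠ L : ℕ in atTop, |fL β L - f β| ≤ η := by
    have := (hconv β).eventually (Metric.closedBall_mem_nhds (f β) hη0)
    filter_upwards [this] with L hL
    simpa [Real.dist_eq] using Metric.mem_closedBall.1 hL
  have ev2 : ∀ᶠ L : ℕ in atTop, |fL β' L - f β'| ≤ η := by
    have := (hconv β').eventually (Metric.closedBall_mem_nhds (f β') hη0)
    filter_upwards [this] with L hL
    simpa [Real.dist_eq] using Metric.mem_closedBall.1 hL
  have ev3 := hKT β' hβ'1
  filter_upwards [ev1, ev2, ev3] with L hL1 hL2 hL3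
  -- the exact per-site identity on the torus of side `L + 1`
  have hid := klDiv_wilsonMeasure_perSite (d := 4) r.ρ r.continuous β β' (L + 1)
  -- K1 with the non-negative constant
  have k1 : |f β + (3 * (D : ℝ) / 2) * Real.log β - K| ≤ max C 0 * η :=
    (hrate β hβ0).trans (mul_le_mul_of_nonneg_right (le_max_left _ _) hη0.le)
  have hη' : β' ^ (-κ) ≤ η := Real.rpow_le_rpow_of_nonpos hβpos hββ' (by linarith)
  have k2 : |f β' + (3 * (D : ℝ) / 2) * Real.log β' - K| ≤ max C 0 * η :=
    (hrate β' hβ'0).trans ((mul_le_mul_of_nonneg_right (le_max_left _ _) (Real.rpow_nonneg hβ'pos.le _)).trans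
      (mul_le_mul_of_nonneg_left hη' (le_max_right _ _)))
  -- KT1 with the non-negative constant, and `β'^{-κ/2} ≤ β^{-κ/2}`
  have hx : β' ^ (-(κ / 2)) ≤ β ^ (-(κ / 2)) := Real.rpow_le_rpow_of_nonpos hβpos hββ' (by linarith)
  have kt : |β' * wilsonExpectation (L := L + 1) r.ρ β' (toTorusObservable (L + 1)
      fun U : LGConfig 4 G => ∑ i : Fin 4, ∑ j : Fin 4,
        if i < j then ((r.N : ℝ) - plaquetteObs r.ρ 0 i j U) else 0) - 3 * (D : ℝ) / 2| ≤
      max C₁ 0 * β' ^ (-(κ / 2)) :=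
    hL3.trans (mul_le_mul_of_nonneg_right (le_max_left _ _) (Real.rpow_nonneg hβ'pos.le _))
  have hfLβ : fL β L = (((L + 1 : ℕ) : ℝ) ^ 4)⁻¹ * torusLogPartition 4 r.ρ β (L + 1) := rfl
  have hfLβ' : fL β' L = (((L + 1 : ℕ) : ℝ) ^ 4)⁻¹ * torusLogPartition 4 r.ρ β' (L + 1) := rfl
  push_cast at hfLβ hfLβ' hid
  rw [← hfLβ, ← hfLβ'] at hid
  have main := scaleEntropy_arith (c := 3 * (D : ℝ) / 2) hβpos hββ' hid hL1 hL2 k1 k2 kt hx (le_max_right _ _)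
  -- bound the three error sizes by `β^{-κ/2}` (`β ≥ 1`)
  have hηx : η ≤ β ^ (-(κ / 2)) := by
    rw [hη]; exact Real.rpow_le_rpow_of_exponent_le hβone (by linarith)
  have hx0 : 0 ≤ β ^ (-(κ / 2)) := Real.rpow_nonneg hβpos.le _
  have hC0 : 0 ≤ max C 0 := le_max_right _ _
  have hC10 : 0 ≤ max C₁ 0 := le_max_right _ _
  calc |((L + 1 : ℝ) ^ 4)⁻¹ * (klDiv (wilsonMeasure (d := 4) (L := L + 1) r.ρ β')
            (wilsonMeasure (d := 4) (L := L + 1) r.ρ β)).toReal -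
          3 * (D : ℝ) / 2 * (Real.log (β' / β) - 1 + β / β')|
        ≤ 2 * (max C 0 * η) + 2 * η + max C₁ 0 * β ^ (-(κ / 2)) := main
    _ ≤ 2 * (max C 0 * β ^ (-(κ / 2))) + 2 * β ^ (-(κ / 2)) + max C₁ 0 * β ^ (-(κ / 2)) := by
        have := mul_le_mul_of_nonneg_left hηx hC0
        linarith
    _ = (2 * max C 0 + 2 + max C₁ 0) * β ^ (-(κ / 2)) := by ring

end Rate

end Summit.QuantumFields.YangMills.Theorems.EntropyBudgetEquipartition.ScaleEntropy

end
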